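import Literature.AlgebraicGeometry.Resolution.BlowupChartRsop
import Literature.AlgebraicGeometry.Resolution.AffineBlowupAlgebra
import Literature.AlgebraicGeometry.Resolution.CharPolyhedronVertexPreparationHolds
import Mathlib.RingTheory.Localization.AtPrime.Basic
import HarnessLib

/-!
# [OURS · L1 W4.2] D18 G5 (ii-a): the chart `R[𝔪/u_{j₀}]` of the blow-up of a regular local ring at its closed point is REGULAR at every
# prime over `𝔪` (read on the affine blowup algebra; an r.s.p. `u` as the centre)
# (cell res-hironaka, LADDER-RESOLUTION rung L; slot W4.2, crux chain w42 `SigmaMaxModificationsCorridor3` stmt-ResolutionOfSingularities-19249;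
# `--supports stmt-ResolutionOfSingularities-19249 --as helper`; hand res-D-brk-3 (gen 6), cut G5 of TAKING 13:03:41Z)

PURE COMMUTATIVE ALGEBRA, 0 `def`s, every declaration PROVED; OURS bookkeeping; NOT a statement of Hironaka's manuscript [Hironaka2017] nor of
[CossartJannsenSaito2020]/[CossartPiltant2019]. AI-written, weaker than expert review.

* `isRsopPart_of_span_range_eq_maximalIdeal` — an r.s.p. `u : Fin n → R` of a regular local ring of dimension `n` is `IsRsopPart u` (no extra
  parameters).
* **`isRegularLocalRing_localization_blowupAlgebra_of_comap_eq`** — for `R` regular local of dimension `n` with r.s.p. `u` and any prime `𝔮` of the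
  chart algebra `R[(u)/u_{j₀}]` (`blowupAlgebra (span (range u)) (u j₀)`, the image model of GW (13.19)) lying over `𝔪_R`, the local ring
  `R[(u)/u_{j₀}]_𝔮` is a REGULAR local ring — the tree's `isRsopPart_chartFamily_reesChart` (de Jong 1996, 2.4: an explicit r.s.p. at every
  point of the chart over the closed point; Liu Thm. 8.1.19 (a)) transported along `reesChartEquiv : (R[It])_{(u_{j₀}t)} ≅ R[(u)/u_{j₀}]`
  (Stacks 07Z3) and `IsLocalization.isLocalization_of_base_ringEquiv`. This is the regularity of the new base `S_𝔮` of the CP frame at a near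
  point (D18 (i)), WITHOUT Serre's «localisations of regular local rings are regular».
* (rev 2) **`isRegularLocalRing_localization_blowupAlgebra_of_comap_eq_along`** — the same for the chart algebra `R[(z)/z_{j₀}]` of the blow-up
  of the REGULAR PRIME `(z)`, `z` PART of an r.s.p. `(z, w)` of `R` (the centre `V(X, z)` of a CP frame ADAPTED to a curve / surface centre,
  D18 (i) for positive-dimensional centres): regular at every prime over `𝔪_R` (the tree lemma with complementary parameters `w`).

References: de Jong 1996, 2.4 [DeJong1996]; Liu Thm. 8.1.19 (a) [Liu2002]; Stacks 0804, 07Z3 [StacksProject]; tree `Resolution/BlowupChartRsop`,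
`Resolution/AffineBlowupAlgebra`.
-/

noncomputable section

set_option linter.dupNamespace false

open IsLocalRing IsLocalization
open Literature.AlgebraicGeometry.Resolution

universe u

namespace Summit.ResolutionOfSingularities.ResolutionOfSingularities.Theorems.SigmaMaxModificationsCorridor3.Helpers

variable {R : Type u} [CommRing R] [IsRegularLocalRing R] {n : ℕ}

/-- An r.s.p. of a regular local ring of dimension `n` is `IsRsopPart` (with no complementary parameters). [cite: Matsumura1987, §14] -/
theorem isRsopPart_of_span_range_eq_maximalIdeal (hdim : ringKrullDim R = n) (u : Fin n → R)
    (hu : Ideal.span (Set.range u) = maximalIdeal R) : IsRsopPart u := by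
  refine ⟨inferInstance, 0, Fin.elim0, by rw [Nat.add_zero]; exact hdim, ?_⟩
  rw [Set.range_eq_empty (Fin.elim0 : Fin 0 → R), Set.union_empty, hu]

set_option maxHeartbeats 800000 in
-- instance unification on the Rees chart ring `chartRing u j₀` is slow (as in `BlowupChartRsop.lean`, `BlowupStalkBlowupAlgebra.lean`)
/-- [OURS · L1 W4.2] **The chart algebra `R[(u)/u_{j₀}]` of the blow-up of the closed point of a regular local ring is regular at every prime
over `𝔪_R`.** `R` regular local of dimension `n`, `u` an r.s.p., `𝔮` a prime of `blowupAlgebra (span (range u)) (u j₀)` with `𝔮 ∩ R = 𝔪_R`: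
`(R[(u)/u_{j₀}])_𝔮` is a regular local ring. [cite: DeJong1996, 2.4] [cite: Liu2002, Thm. 8.1.19 (a)] -/
theorem isRegularLocalRing_localization_blowupAlgebra_of_comap_eq (hdim : ringKrullDim R = n) (u : Fin n → R)
    (hu : Ideal.span (Set.range u) = maximalIdeal R) (j₀ : Fin n)
    (𝔮 : Ideal (blowupAlgebra (Ideal.span (Set.range u)) (u j₀))) [𝔮.IsPrime]
    (h𝔮 : 𝔮.comap (algebraMap R (blowupAlgebra (Ideal.span (Set.range u)) (u j₀))) = maximalIdeal R) :
    IsRegularLocalRing (Localization.AtPrime 𝔮) := by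
  -- the Rees chart `chartRing u j₀ ≅ blowupAlgebra (span (range u)) (u j₀)`
  set ε : chartRing u j₀ ≃+* blowupAlgebra (Ideal.span (Set.range u)) (u j₀) :=
    reesChartEquiv (I := Ideal.span (Set.range u)) (u j₀) (Ideal.mem_span_range_self (f := u) (x := j₀)) with hε
  have hεbase : ∀ r : R, ε (chartBase u j₀ r) = algebraMap R _ r := fun r => reesChartEquiv_reesChartBase (u j₀) _ r
  -- the prime of the Rees chart and the localisation structure over it
  set 𝔓 : Ideal (chartRing u j₀) := 𝔮.comap ε.toRingHom with h𝔓
  haveI : 𝔓.IsPrime := Ideal.comap_isPrime _ _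
  letI algC : Algebra (chartRing u j₀) (Localization.AtPrime 𝔮) :=
    ((algebraMap (blowupAlgebra (Ideal.span (Set.range u)) (u j₀)) (Localization.AtPrime 𝔮)).comp ε.symm.symm.toRingHom).toAlgebra
  have hM : 𝔮.primeCompl.map ε.symm = 𝔓.primeCompl := by
    ext y
    simp only [Submonoid.mem_map, Ideal.mem_primeCompl_iff]
    constructor
    · rintro ⟨x, hx, rfl⟩
      intro hy
      apply hx
      have : ε (ε.symm x) ∈ 𝔮 := hy
      rwa [ε.apply_symm_apply] at this
    · intro hy
      refine ⟨ε y, fun hx => hy ?_, ?_⟩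
      · change ε.toRingHom y ∈ 𝔮
        exact hx
      · exact ε.symm_apply_apply y
  haveI hloc : IsLocalization.AtPrime (Localization.AtPrime 𝔮) 𝔓 := by
    have h := IsLocalization.isLocalization_of_base_ringEquiv 𝔮.primeCompl (Localization.AtPrime 𝔮) (P := chartRing u j₀) ε.symm
    change IsLocalization _ _
    rwa [hM] at h
  -- the tree's explicit r.s.p. at `𝔓`
  have h𝔓 : 𝔓.comap (chartBase u j₀) = maximalIdeal R := by
    rw [h𝔓, Ideal.comap_comap]
    have : ε.toRingHom.comp (chartBase u j₀) = algebraMap R (blowupAlgebra (Ideal.span (Set.range u)) (u j₀)) :=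
      RingHom.ext fun r => hεbase r
    rw [this, h𝔮]
  have hz : Ideal.span (Set.range (Fin.append u Fin.elim0)) = maximalIdeal R := by
    rw [Fin.append_elim0]
    change Ideal.span (Set.range (u ∘ ⇑(finCongr (Nat.add_zero n)))) = _
    rw [(finCongr (Nat.add_zero n)).surjective.range_comp u, hu]
  have hd : (maximalIdeal R).spanFinrank = n + 0 :=
    Literature.AlgebraicGeometry.Resolution.CossartPiltant.spanFinrank_maximalIdeal_eq_of_ringKrullDim_eq hdim
  exact (isRsopPart_chartFamily_reesChart u j₀ Fin.elim0 hz hd 𝔓 h𝔓 (Localization.AtPrime 𝔮) (a := 0)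
    (fun k => Fin.elim0 k) (Function.injective_of_subsingleton _) (fun k => Fin.elim0 k)).1

set_option maxHeartbeats 800000 in
-- instance unification on the Rees chart ring `chartRing z j₀` is slow (as above)
/-- [OURS · L1 W4.2] (rev 2) **The chart algebra `R[(z)/z_{j₀}]` of the blow-up of a regular prime `(z)` — `z` part of an r.s.p. `(z, w)` of the
regular local ring `R` of dimension `d + l` — is regular at every prime over `𝔪_R`.** [cite: DeJong1996, 2.4] [cite: Liu2002, Thm. 8.1.19 (a)] -/
theorem isRegularLocalRing_localization_blowupAlgebra_of_comap_eq_along {d l : ℕ} (hdim : ringKrullDim R = (d + l : ℕ))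
    (z : Fin d → R) (w : Fin l → R) (hzw : Ideal.span (Set.range (Fin.append z w)) = maximalIdeal R) (j₀ : Fin d)
    (𝔮 : Ideal (blowupAlgebra (Ideal.span (Set.range z)) (z j₀))) [𝔮.IsPrime]
    (h𝔮 : 𝔮.comap (algebraMap R (blowupAlgebra (Ideal.span (Set.range z)) (z j₀))) = maximalIdeal R) :
    IsRegularLocalRing (Localization.AtPrime 𝔮) := by
  -- the Rees chart `chartRing z j₀ ≅ blowupAlgebra (span (range z)) (z j₀)`
  set ε : chartRing z j₀ ≃+* blowupAlgebra (Ideal.span (Set.range z)) (z j₀) :=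
    reesChartEquiv (I := Ideal.span (Set.range z)) (z j₀) (Ideal.mem_span_range_self (f := z) (x := j₀)) with hε
  have hεbase : ∀ r : R, ε (chartBase z j₀ r) = algebraMap R _ r := fun r => reesChartEquiv_reesChartBase (z j₀) _ r
  -- the prime of the Rees chart and the localisation structure over it
  set 𝔓 : Ideal (chartRing z j₀) := 𝔮.comap ε.toRingHom with h𝔓
  haveI : 𝔓.IsPrime := Ideal.comap_isPrime _ _
  letI algC : Algebra (chartRing z j₀) (Localization.AtPrime 𝔮) :=
    ((algebraMap (blowupAlgebra (Ideal.span (Set.range z)) (z j₀)) (Localization.AtPrime 𝔮)).comp ε.symm.symm.toRingHom).toAlgebra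
  have hM : 𝔮.primeCompl.map ε.symm = 𝔓.primeCompl := by
    ext y
    simp only [Submonoid.mem_map, Ideal.mem_primeCompl_iff]
    constructor
    · rintro ⟨x, hx, rfl⟩
      intro hy
      apply hx
      have : ε (ε.symm x) ∈ 𝔮 := hy
      rwa [ε.apply_symm_apply] at this
    · intro hy
      refine ⟨ε y, fun hx => hy ?_, ?_⟩
      · change ε.toRingHom y ∈ 𝔮
        exact hx
      · exact ε.symm_apply_apply y
  haveI hloc : IsLocalization.AtPrime (Localization.AtPrime 𝔮) 𝔓 := by
    have h := IsLocalization.isLocalization_of_base_ringEquiv 𝔮.primeCompl (Localization.AtPrime 𝔮) (P := chartRing z j₀) ε.symm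
    change IsLocalization _ _
    rwa [hM] at h
  -- the tree's explicit r.s.p. at `𝔓`, with the complementary parameters `w`
  have h𝔓 : 𝔓.comap (chartBase z j₀) = maximalIdeal R := by
    rw [h𝔓, Ideal.comap_comap]
    have : ε.toRingHom.comp (chartBase z j₀) = algebraMap R (blowupAlgebra (Ideal.span (Set.range z)) (z j₀)) :=
      RingHom.ext fun r => hεbase r
    rw [this, h𝔮]
  have hd : (maximalIdeal R).spanFinrank = d + l :=
    Literature.AlgebraicGeometry.Resolution.CossartPiltant.spanFinrank_maximalIdeal_eq_of_ringKrullDim_eq hdim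
  exact (isRsopPart_chartFamily_reesChart z j₀ w hzw hd 𝔓 h𝔓 (Localization.AtPrime 𝔮) (a := 0)
    (fun k => Fin.elim0 k) (Function.injective_of_subsingleton _) (fun k => Fin.elim0 k)).1

end Summit.ResolutionOfSingularities.ResolutionOfSingularities.Theorems.SigmaMaxModificationsCorridor3.Helpers

end
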